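import Summits.CriticalPhenomena.SAWScalingLimit.Theorems.SAWTotalPositivitySAWTraversalBoundShellCrossing
import Summits.CriticalPhenomena.SAWScalingLimit.Theorems.ShellCrossingBound.Negative.RadiiThreshold
import Summits.CriticalPhenomena.SAWScalingLimit.Theorems.ShellCrossingBound.Negative.UniformThresholdFalse

/-!
# `SAWTotalPositivity.SAWTraversalBound` (stmt-CriticalPhenomena-1880): where the content of the
# threshold sits

Support file for the statement item `SAWTraversalBound` of route `SAWTotalPositivity` (shared
verbatim with routes `SAWLeftRightFKG`, `SAWTargetMonotonicity`): the Aizenman–Burchard hypothesis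
(H1) for the critical square-lattice SAW with a SHELL-DEPENDENT traversal threshold `k x ρ R`.
The item is certified equivalent to eventual tightness of the critical SAW laws
(`sawTraversalBound_iff_eventualTight`, `sawTraversalBound_iff_renewalEventualTight`). This file
records, in the item's own vocabulary, the two facts that pin down which part of its quantifier
structure carries weight — the threshold census a planner needs before restating or merging it:

* `sawTraversalBound_iff_radiiThreshold` — the dependence of the threshold on the CENTRE `x`, the
  constants `K`, `λ` and the side conditions `δ ≤ ρ`, `R ≤ 1` are all decorative: the item is
  equivalent to the bound `P_δ[k ρ R separate traversals of D(x; ρ, R)] ≤ (ρ/R)³` with a threshold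
  depending on the RADII only, for every centre and all `0 < ρ < R` (through tightness and the
  compactness lemma `ShellCrossingBound.Negative.radiiThreshold_of_eventualTight` of the standing
  disproof of crux stmt-CriticalPhenomena-4728).
* `not_sawTraversalBound_uniformThreshold` — the dependence on the radii is NOT decorative: with ONE
  threshold `k : ℕ` for all shells (the literal Aizenman–Burchard (H1)) the statement is FALSE for
  the critical SAW, by the deterministic boundary forcing of
  `ShellCrossingBound.Negative.not_uniformThreshold` (a Dobrushin domain whose boundary near the
  marked point forces `k` traversals of a thin shell at every small mesh).

Consequently the item is stated as intended (the free threshold is load-bearing, not a typing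
slip), it is exactly uniform-in-mesh precompactness of the critical planar SAW (open,
Lawler–Schramm–Werner 2004 §3.4.2), and a version with content beyond tightness can only fix the
threshold on interior shells. No named fact is used.
-/

noncomputable section

open MeasureTheory Filter Topology Set Metric
open Literature.Probability.RandomPlanarGeometry Literature.Probability.LatticeModels
open scoped ENNReal unitInterval

namespace Summit.CriticalPhenomena.SAWScalingLimit.Theorems

open Summit.CriticalPhenomena.SAWScalingLimit.Theses

/-- **stmt-1880 with a radii-only threshold.** `SAWTraversalBound` is equivalent to: for every
Dobrushin domain and endpoint approximation there are a threshold `k ρ R` depending on the radii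
only and `δ₀ > 0` with `P_δ[k ρ R separate traversals of D(x; ρ, R)] ≤ (ρ/R)³` for all
`δ ∈ (0, δ₀]`, every centre `x` and all `0 < ρ < R` (no `δ ≤ ρ`, no `R ≤ 1`, `K = 1`, `λ = 3`).
`→`: stmt-1880 ⟹ eventual tightness (`sawTraversalBound_iff_renewalEventualTight`) ⟹ radii-only
thresholds for any positive target (`radiiThreshold_of_eventualTight`: on a compact set of curve
classes the traversal numbers of the shells `D(x; ρ, R)`, `ρ < R` fixed, are bounded uniformly in
`x`). `←`: specialise. [folklore] -/
theorem sawTraversalBound_iff_radiiThreshold :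
    SAWTotalPositivity.SAWTraversalBound ↔
    ∀ (D : DobrushinDomain) (a b : ℝ → Site 2), SAW.IsEndpointApprox D a b →
      ∃ (k : ℝ → ℝ → ℕ) (δ₀ : ℝ), 0 < δ₀ ∧ ∀ δ ∈ Set.Ioc (0 : ℝ) δ₀, ∀ (x : ℂ) (ρ R : ℝ),
        0 < ρ → ρ < R →
          SAW.law D.carrier δ (a δ) (b δ)
            {γ | (⟨γ.walk.toCurve (meshPoint δ)⟩ : Curve ℂ).HasTraversals (k ρ R) x ρ R}
              ≤ ENNReal.ofReal ((ρ / R) ^ (3 : ℝ)) := by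
  constructor
  · intro h D a b hab
    have hT : SAWRenewalTightness.EventualTight := sawTraversalBound_iff_renewalEventualTight.1 h
    obtain ⟨k, δ₀, hδ₀, hk⟩ :=
      ShellCrossingBound.Negative.radiiThreshold_of_eventualTight hT D a b hab
    refine ⟨k, δ₀, hδ₀, fun δ hδ x ρ R hρ hρR => ?_⟩
    simpa only [one_mul] using hk δ hδ x ρ R hρ hρR
  · intro h D a b hab
    obtain ⟨k, δ₀, hδ₀, hk⟩ := h D a b hab
    refine ⟨fun _ ρ R => k ρ R, 1, 3, δ₀, zero_le_one, by norm_num, hδ₀, ?_⟩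
    intro δ hδ x ρ R hδρ hρR _hR
    simpa only [one_mul] using hk δ hδ x ρ R (hδ.1.trans_le hδρ) hρR

/-- **The uniform-threshold mutation of stmt-1880 is FALSE.** Replacing the shell-dependent
threshold `k x ρ R` of `SAWTraversalBound` by ONE `k : ℕ` for all shells (keeping `0 ≤ K`,
`2 < λ`, `δ ≤ ρ < R ≤ 1`, `δ ≤ δ₀(D, a, b)`) gives a false statement about the critical SAW: drop
`0 ≤ K` and apply `ShellCrossingBound.Negative.not_uniformThreshold` (boundary forcing: an explicit
Dobrushin domain in which, for every `k` and `ε > 0`, some shell of aspect ratio `< ε` is traversed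
`k` times by EVERY self-avoiding walk between the lattice endpoints at all small meshes). So the
shell-dependence of the threshold in the item is load-bearing. [folklore] -/
theorem not_sawTraversalBound_uniformThreshold :
    ¬ (∀ (D : DobrushinDomain) (a b : ℝ → Site 2), SAW.IsEndpointApprox D a b →
      ∃ (k : ℕ) (K lam δ₀ : ℝ), 0 ≤ K ∧ 2 < lam ∧ 0 < δ₀ ∧ ∀ δ ∈ Set.Ioc (0 : ℝ) δ₀,
        ∀ (x : ℂ) (ρ R : ℝ), δ ≤ ρ → ρ < R → R ≤ 1 →
          SAW.law D.carrier δ (a δ) (b δ)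
            {γ | (⟨γ.walk.toCurve (meshPoint δ)⟩ : Curve ℂ).HasTraversals k x ρ R}
              ≤ ENNReal.ofReal (K * (ρ / R) ^ lam)) := fun h =>
  ShellCrossingBound.Negative.not_uniformThreshold fun D a b hab => by
    obtain ⟨k, K, lam, δ₀, -, hlam, hδ₀, hb⟩ := h D a b hab
    exact ⟨k, K, lam, δ₀, hlam, hδ₀, hb⟩

end Summit.CriticalPhenomena.SAWScalingLimit.Theorems

end
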